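import Summits.AtomisticToContinuum.Crystallization.Theorems.FreeSplittingCertificatesStrictSplittingRuleP1BareWeightTranslate
import Summits.AtomisticToContinuum.Crystallization.Theorems.FreeSplittingCertificatesStrictSplittingRuleP1FluxFormTranslate

/-!
# `StrictSplittingRule` (stmt-AtomisticToContinuum-12560): the continuum far demand `∫χ²N_F2(ṽ_p)` SPLIT into its gradient, radial and credit integrals, and the gradient part as a cell sum with re-centred weights (P1 interpolant object, part 52)

Route `FreeSplittingCertificates`, crux r3 `StrictSplittingRule` (H12⋆ = `stub_coreJointCoercive`), unit b2b-freesplit-B gen 32.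
VALUE = the analytic glue between the far inequality (T3) and the demand-side bricks (T6)/(T7) of the kernel assembly map (HOME FAR-LEMMA-SPEC §23 (b)): the far theorem
delivers ONE integral `∫χ²N_F2(x, ṽ(x), ∇ṽ(x))dx` for the re-based far-ledger field `ṽ(x) = v(y₀ + x)`; the assembly needs it as (gradient part) + (radial deficit) − (credit),
the gradient part written cell by cell against the re-centred capacity integrals `∫_T χ(y−y₀)²|y−y₀|⁻⁶dy` (what the per-cell budget (B) is stated with), and the radial/credit parts
in the form of parts 45/47.  Here:
* `integrable_chiSq_fpNumI_of_lipschitz`, `integrable_chiSq_fpDen_of_lipschitz` — for ANY continuous Lipschitz field and the ledger weight `χ = fpChi S₁ S₂` (majorants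
  `abs_fpNumI_le`/`abs_fpDen_le` × `integrable_chiSq_mul_invPow`); instances `…_p1Disp_translate` for the translated far-ledger field;
* `integrable_chiSq_radial_p1Disp_translate`, `integrable_chiSq_credit_p1Disp_translate` — the radial and credit densities of `N_F2` along `ṽ` are integrable;
* **`integral_chiSq_fpNumI_split`** — `∫χ²N = ∫χ²·grad + ∫χ²·radial − ∫χ²·credit` for `ṽ` (linearity with the three integrabilities);
* **`integral_weight_fpGrad_translate_eq_tsum`** — `∫ w(x)·g(∇ṽ(x))dx = Σ'_T g(G_T(U) − A)·∫_T w(y − y₀)dy` for any weight and gradient functional (translation invariance + the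
  general cell decomposition `integral_weight_fpGrad_eq_tsum` of part 16); instance **`integral_chiSq_grad_translate_eq_tsum`** for the gradient part of `N(f_S,f_A,·,·)`.
NOT a proof of H12⋆, NOT summit progress.  [folklore]
-/

noncomputable section

open Set Function Metric MeasureTheory Filter Topology
open scoped BigOperators NNReal ENNReal

namespace Summit.AtomisticToContinuum.Crystallization.Theorems.StrictSplittingRuleBirth

open Literature.MathematicalPhysics.StatisticalMechanics
open Summit.AtomisticToContinuum.Crystallization.Theorems.PalmUnimodularRigidity.LayeredLawsSelectHcp

/-! ## Integrability of `χ²N` and `χ²Den` along a continuous Lipschitz field -/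

/-- `χ²·N(f_S,f_A,D,C)` is integrable along any continuous `K`-Lipschitz field (`χ = fpChi S₁ S₂`, `0 < S₁ < S₂`). -/
theorem integrable_chiSq_fpNumI_of_lipschitz {S1 S2 : ℝ} (hS1 : 0 < S1) (hS12 : S1 < S2) (fS fA D C : ℝ)
    {v : (Fin 3 → ℝ) → (Fin 3 → ℝ)} {K : ℝ≥0} (hK : LipschitzWith K v) (hv : Continuous v) :
    Integrable fun x => fpChi S1 S2 x ^ 2 * fpNumI fS fA D C x (v x) (fpGrad v x) := by
  have hχ : ContDiff ℝ 2 (fpChi S1 S2) := contDiff_two_fpChi S1 S2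
  have hχ0 : (0 : Fin 3 → ℝ) ∉ tsupport (fpChi S1 S2) := zero_notMem_tsupport_fpChi hS1 hS12
  have hS2 : (0 : ℝ) ≤ Real.sqrt S2 := Real.sqrt_nonneg _
  have hχ1 : ∀ y : Fin 3 → ℝ, Real.sqrt S2 ≤ ‖y‖ → fpChi S1 S2 y = 1 :=
    fun y hy => fpChi_eq_one_of_norm_ge hS12 hS2 (by rw [Real.sq_sqrt (hS1.trans hS12).le]) y hy
  have hGn : ∀ x i j, |fpGrad v x i j| ≤ K := fun x i j => abs_fpGrad_le_of_lipschitz hK x i j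
  have hwn : ∀ x, ‖v x‖ ≤ ‖v 0‖ + K * ‖x‖ := fun x => norm_le_of_lipschitz hK x
  refine Integrable.mono' (integrable_chiSq_mul_invPow hχ hχ0 hχ1
      ((3 / 8 * (|fS| + |fA|) + 3 / 2 * (|7 * D + C| + |C|)) * (K : ℝ) ^ 2) (3 / 2 * (|7 * D + C| + |C|) * ‖v 0‖ ^ 2))
    (measurable_chiSq_mul_fpNumI fS fA D C hv hχ.continuous).aestronglyMeasurable (ae_of_all _ fun x => ?_)
  rw [Real.norm_eq_abs, abs_mul, abs_of_nonneg (sq_nonneg _)]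
  exact mul_le_mul_of_nonneg_left (abs_fpNumI_le fS fA D C (hGn x) (hwn x)) (sq_nonneg _)

/-- `χ²·Den` is integrable along any continuous `K`-Lipschitz field. -/
theorem integrable_chiSq_fpDen_of_lipschitz {S1 S2 : ℝ} (hS1 : 0 < S1) (hS12 : S1 < S2)
    {v : (Fin 3 → ℝ) → (Fin 3 → ℝ)} {K : ℝ≥0} (hK : LipschitzWith K v) :
    Integrable fun x => fpChi S1 S2 x ^ 2 * fpDen x (fpGrad v x) := by
  have hχ : ContDiff ℝ 2 (fpChi S1 S2) := contDiff_two_fpChi S1 S2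
  have hχ0 : (0 : Fin 3 → ℝ) ∉ tsupport (fpChi S1 S2) := zero_notMem_tsupport_fpChi hS1 hS12
  have hS2 : (0 : ℝ) ≤ Real.sqrt S2 := Real.sqrt_nonneg _
  have hχ1 : ∀ y : Fin 3 → ℝ, Real.sqrt S2 ≤ ‖y‖ → fpChi S1 S2 y = 1 :=
    fun y hy => fpChi_eq_one_of_norm_ge hS12 hS2 (by rw [Real.sq_sqrt (hS1.trans hS12).le]) y hy
  have hGn : ∀ x i j, |fpGrad v x i j| ≤ K := fun x i j => abs_fpGrad_le_of_lipschitz hK x i j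
  refine Integrable.mono' (integrable_chiSq_mul_invPow hχ hχ0 hχ1 (108 / 5 * (K : ℝ) ^ 2) 0)
    (measurable_chiSq_mul_fpDen (v := v) hχ.continuous).aestronglyMeasurable (ae_of_all _ fun x => ?_)
  rw [Real.norm_eq_abs, abs_mul, abs_of_nonneg (sq_nonneg _), zero_mul, add_zero]
  exact mul_le_mul_of_nonneg_left (abs_fpDen_le (hGn x)) (sq_nonneg _)

/-- `χ²·N_(·)` is integrable along the translated far-ledger field `x ↦ p1Disp a h U b₀ A (y₀ + x)`. -/
theorem integrable_chiSq_fpNumI_p1Disp_translate {a h S1 S2 : ℝ} (ha : 0 < a) (hh : 0 < h) (hS1 : 0 < S1) (hS12 : S1 < S2)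
    (fS fA D C : ℝ) (U : ℤ × ℤ × ℤ → (Fin 3 → ℝ)) (hU : (support U).Finite) (b₀ : Fin 3 → ℝ) (A : Fin 3 → Fin 3 → ℝ) (y₀ : Fin 3 → ℝ) :
    Integrable fun x => fpChi S1 S2 x ^ 2 *
      fpNumI fS fA D C x (p1Disp a h U b₀ A (y₀ + x)) (fpGrad (fun y => p1Disp a h U b₀ A (y₀ + y)) x) := by
  obtain ⟨K, hK⟩ := exists_lipschitzWith_p1Disp ha.ne' hh.ne' U hU b₀ A
  exact integrable_chiSq_fpNumI_of_lipschitz hS1 hS12 fS fA D C (lipschitzWith_translate hK y₀)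
    ((continuous_p1Disp a h U b₀ A).comp (continuous_const.add continuous_id))

/-- `χ²·Den` is integrable along the translated far-ledger field. -/
theorem integrable_chiSq_fpDen_p1Disp_translate {a h S1 S2 : ℝ} (ha : 0 < a) (hh : 0 < h) (hS1 : 0 < S1) (hS12 : S1 < S2)
    (U : ℤ × ℤ × ℤ → (Fin 3 → ℝ)) (hU : (support U).Finite) (b₀ : Fin 3 → ℝ) (A : Fin 3 → Fin 3 → ℝ) (y₀ : Fin 3 → ℝ) :
    Integrable fun x => fpChi S1 S2 x ^ 2 * fpDen x (fpGrad (fun y => p1Disp a h U b₀ A (y₀ + y)) x) := by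
  obtain ⟨K, hK⟩ := exists_lipschitzWith_p1Disp ha.ne' hh.ne' U hU b₀ A
  exact integrable_chiSq_fpDen_of_lipschitz hS1 hS12 (lipschitzWith_translate hK y₀)

/-! ## Integrability of the radial and credit densities along the translated field -/

/-- The radial density `χ²·c·s⁻⁵⟪x,ṽ⟫²` is integrable along the translated far-ledger field (`c ≥ 0`). -/
theorem integrable_chiSq_radial_p1Disp_translate {a h S1 S2 : ℝ} (ha : 0 < a) (hh : 0 < h) (hS1 : 0 < S1) (hS12 : S1 < S2)
    {c : ℝ} (hc : 0 ≤ c) (U : ℤ × ℤ × ℤ → (Fin 3 → ℝ)) (hU : (support U).Finite) (b₀ : Fin 3 → ℝ) (A : Fin 3 → Fin 3 → ℝ) (y₀ : Fin 3 → ℝ) :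
    Integrable fun x => c * fpChi S1 S2 x ^ 2 * (fpSq x)⁻¹ ^ 5 * fpDot x (p1Disp a h U b₀ A (y₀ + x)) ^ 2 := by
  -- the y-form integrand of parts 41/45 is integrable; translate it
  have hint := integrable_p1Quad3_p1Disp ha hh (fun y k l => c * fpChi S1 S2 (y - y₀) ^ 2 * (fpSq (y - y₀))⁻¹ ^ 5 * ((y - y₀) k * (y - y₀) l))
    (continuous_radWeight_translate hS1 hS12 c y₀) (fun y u => p1Quad3_radWeight_nonneg hc S1 S2 (y - y₀) u)
    (fun y u => p1Quad3_radWeight_le hc S1 S2 (y - y₀) u) (integrable_bareMajorant_growth_translate hS1 hS12 c hc y₀) U hU b₀ A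
  have h1 := hint.comp_add_left y₀
  refine h1.congr (Eventually.of_forall fun x => ?_)
  simp only [add_sub_cancel_left, p1Quad3_radWeight]

/-- The credit density `χ²·c·s⁻⁴|ṽ|²` is integrable along the translated far-ledger field (`c ≥ 0`). -/
theorem integrable_chiSq_credit_p1Disp_translate {a h S1 S2 : ℝ} (ha : 0 < a) (hh : 0 < h) (hS1 : 0 < S1) (hS12 : S1 < S2)
    {c : ℝ} (hc : 0 ≤ c) (U : ℤ × ℤ × ℤ → (Fin 3 → ℝ)) (hU : (support U).Finite) (b₀ : Fin 3 → ℝ) (A : Fin 3 → Fin 3 → ℝ) (y₀ : Fin 3 → ℝ) :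
    Integrable fun x => c * fpChi S1 S2 x ^ 2 * (fpSq x)⁻¹ ^ 4 *
      (p1Disp a h U b₀ A (y₀ + x) 0 ^ 2 + p1Disp a h U b₀ A (y₀ + x) 1 ^ 2 + p1Disp a h U b₀ A (y₀ + x) 2 ^ 2) := by
  have hint := integrable_p1Quad3_p1Disp ha hh
    (fun y k l => c * fpChi S1 S2 (y - y₀) ^ 2 * (fpSq (y - y₀))⁻¹ ^ 4 * (if k = l then 1 else 0))
    (continuous_credWeight_translate hS1 hS12 c y₀) (fun y u => p1Quad3_credWeight_nonneg hc S1 S2 (y - y₀) u)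
    (fun y u => p1Quad3_credWeight_le c S1 S2 (y - y₀) u) (integrable_bareMajorant_growth_translate hS1 hS12 c hc y₀) U hU b₀ A
  have h1 := hint.comp_add_left y₀
  refine h1.congr (Eventually.of_forall fun x => ?_)
  simp only [add_sub_cancel_left, p1Quad3_credWeight]

/-! ## The split of `∫χ²N` -/

/-- **`∫χ²N(f_S,f_A,D,C) = ∫χ²·grad + ∫χ²·radial − ∫χ²·credit`** along the translated far-ledger field, for `7D + C ≥ 0`, `C ≥ 0`.
NOT a proof of H12⋆, NOT summit progress. -/
theorem integral_chiSq_fpNumI_split {a h S1 S2 : ℝ} (ha : 0 < a) (hh : 0 < h) (hS1 : 0 < S1) (hS12 : S1 < S2)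
    (fS fA D C : ℝ) (hDC : 0 ≤ (7 * D + C) / 4) (hC : 0 ≤ C / 4)
    (U : ℤ × ℤ × ℤ → (Fin 3 → ℝ)) (hU : (support U).Finite) (b₀ : Fin 3 → ℝ) (A : Fin 3 → Fin 3 → ℝ) (y₀ : Fin 3 → ℝ) :
    Integrable (fun x => fpChi S1 S2 x ^ 2 *
      (fS * (1 / 24 * (fpSq x)⁻¹ ^ 3 * fpSymSq (fpGrad (fun y => p1Disp a h U b₀ A (y₀ + y)) x)) +
        fA * (1 / 24 * (fpSq x)⁻¹ ^ 3 * (fpFrob (fpGrad (fun y => p1Disp a h U b₀ A (y₀ + y)) x) -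
          fpSymSq (fpGrad (fun y => p1Disp a h U b₀ A (y₀ + y)) x))))) ∧
    ∫ x, fpChi S1 S2 x ^ 2 *
        fpNumI fS fA D C x (p1Disp a h U b₀ A (y₀ + x)) (fpGrad (fun y => p1Disp a h U b₀ A (y₀ + y)) x) =
      (∫ x, fpChi S1 S2 x ^ 2 *
        (fS * (1 / 24 * (fpSq x)⁻¹ ^ 3 * fpSymSq (fpGrad (fun y => p1Disp a h U b₀ A (y₀ + y)) x)) +
          fA * (1 / 24 * (fpSq x)⁻¹ ^ 3 * (fpFrob (fpGrad (fun y => p1Disp a h U b₀ A (y₀ + y)) x) -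
            fpSymSq (fpGrad (fun y => p1Disp a h U b₀ A (y₀ + y)) x))))) +
      (∫ x, (7 * D + C) / 4 * fpChi S1 S2 x ^ 2 * (fpSq x)⁻¹ ^ 5 * fpDot x (p1Disp a h U b₀ A (y₀ + x)) ^ 2) -
      ∫ x, C / 4 * fpChi S1 S2 x ^ 2 * (fpSq x)⁻¹ ^ 4 *
        (p1Disp a h U b₀ A (y₀ + x) 0 ^ 2 + p1Disp a h U b₀ A (y₀ + x) 1 ^ 2 + p1Disp a h U b₀ A (y₀ + x) 2 ^ 2) := by
  have hN := integrable_chiSq_fpNumI_p1Disp_translate ha hh hS1 hS12 fS fA D C U hU b₀ A y₀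
  have hR := integrable_chiSq_radial_p1Disp_translate ha hh hS1 hS12 hDC U hU b₀ A y₀
  have hCr := integrable_chiSq_credit_p1Disp_translate ha hh hS1 hS12 hC U hU b₀ A y₀
  -- pointwise: χ²N = χ²grad + radial − credit
  have hpt : ∀ x, fpChi S1 S2 x ^ 2 *
        fpNumI fS fA D C x (p1Disp a h U b₀ A (y₀ + x)) (fpGrad (fun y => p1Disp a h U b₀ A (y₀ + y)) x) =
      fpChi S1 S2 x ^ 2 *
        (fS * (1 / 24 * (fpSq x)⁻¹ ^ 3 * fpSymSq (fpGrad (fun y => p1Disp a h U b₀ A (y₀ + y)) x)) +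
          fA * (1 / 24 * (fpSq x)⁻¹ ^ 3 * (fpFrob (fpGrad (fun y => p1Disp a h U b₀ A (y₀ + y)) x) -
            fpSymSq (fpGrad (fun y => p1Disp a h U b₀ A (y₀ + y)) x)))) +
      (7 * D + C) / 4 * fpChi S1 S2 x ^ 2 * (fpSq x)⁻¹ ^ 5 * fpDot x (p1Disp a h U b₀ A (y₀ + x)) ^ 2 -
      C / 4 * fpChi S1 S2 x ^ 2 * (fpSq x)⁻¹ ^ 4 *
        (p1Disp a h U b₀ A (y₀ + x) 0 ^ 2 + p1Disp a h U b₀ A (y₀ + x) 1 ^ 2 + p1Disp a h U b₀ A (y₀ + x) 2 ^ 2) := by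
    intro x
    unfold fpNumI
    ring
  -- the gradient part is integrable as χ²N − radial + credit
  have hG : Integrable (fun x => fpChi S1 S2 x ^ 2 *
      (fS * (1 / 24 * (fpSq x)⁻¹ ^ 3 * fpSymSq (fpGrad (fun y => p1Disp a h U b₀ A (y₀ + y)) x)) +
        fA * (1 / 24 * (fpSq x)⁻¹ ^ 3 * (fpFrob (fpGrad (fun y => p1Disp a h U b₀ A (y₀ + y)) x) -
          fpSymSq (fpGrad (fun y => p1Disp a h U b₀ A (y₀ + y)) x))))) := by
    refine ((hN.sub hR).add hCr).congr (Eventually.of_forall fun x => ?_)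
    simp only [Pi.add_apply, Pi.sub_apply, hpt x]
    ring
  refine ⟨hG, ?_⟩
  have e1 : ∫ x, (fpChi S1 S2 x ^ 2 *
        (fS * (1 / 24 * (fpSq x)⁻¹ ^ 3 * fpSymSq (fpGrad (fun y => p1Disp a h U b₀ A (y₀ + y)) x)) +
          fA * (1 / 24 * (fpSq x)⁻¹ ^ 3 * (fpFrob (fpGrad (fun y => p1Disp a h U b₀ A (y₀ + y)) x) -
            fpSymSq (fpGrad (fun y => p1Disp a h U b₀ A (y₀ + y)) x)))) +
      (7 * D + C) / 4 * fpChi S1 S2 x ^ 2 * (fpSq x)⁻¹ ^ 5 * fpDot x (p1Disp a h U b₀ A (y₀ + x)) ^ 2 -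
      C / 4 * fpChi S1 S2 x ^ 2 * (fpSq x)⁻¹ ^ 4 *
        (p1Disp a h U b₀ A (y₀ + x) 0 ^ 2 + p1Disp a h U b₀ A (y₀ + x) 1 ^ 2 + p1Disp a h U b₀ A (y₀ + x) 2 ^ 2)) =
      (∫ x, (fpChi S1 S2 x ^ 2 *
        (fS * (1 / 24 * (fpSq x)⁻¹ ^ 3 * fpSymSq (fpGrad (fun y => p1Disp a h U b₀ A (y₀ + y)) x)) +
          fA * (1 / 24 * (fpSq x)⁻¹ ^ 3 * (fpFrob (fpGrad (fun y => p1Disp a h U b₀ A (y₀ + y)) x) -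
            fpSymSq (fpGrad (fun y => p1Disp a h U b₀ A (y₀ + y)) x)))) +
      (7 * D + C) / 4 * fpChi S1 S2 x ^ 2 * (fpSq x)⁻¹ ^ 5 * fpDot x (p1Disp a h U b₀ A (y₀ + x)) ^ 2)) -
      ∫ x, C / 4 * fpChi S1 S2 x ^ 2 * (fpSq x)⁻¹ ^ 4 *
        (p1Disp a h U b₀ A (y₀ + x) 0 ^ 2 + p1Disp a h U b₀ A (y₀ + x) 1 ^ 2 + p1Disp a h U b₀ A (y₀ + x) 2 ^ 2) :=
    integral_sub (hG.add hR) hCr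
  have e2 : ∫ x, (fpChi S1 S2 x ^ 2 *
        (fS * (1 / 24 * (fpSq x)⁻¹ ^ 3 * fpSymSq (fpGrad (fun y => p1Disp a h U b₀ A (y₀ + y)) x)) +
          fA * (1 / 24 * (fpSq x)⁻¹ ^ 3 * (fpFrob (fpGrad (fun y => p1Disp a h U b₀ A (y₀ + y)) x) -
            fpSymSq (fpGrad (fun y => p1Disp a h U b₀ A (y₀ + y)) x)))) +
      (7 * D + C) / 4 * fpChi S1 S2 x ^ 2 * (fpSq x)⁻¹ ^ 5 * fpDot x (p1Disp a h U b₀ A (y₀ + x)) ^ 2) =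
      (∫ x, fpChi S1 S2 x ^ 2 *
        (fS * (1 / 24 * (fpSq x)⁻¹ ^ 3 * fpSymSq (fpGrad (fun y => p1Disp a h U b₀ A (y₀ + y)) x)) +
          fA * (1 / 24 * (fpSq x)⁻¹ ^ 3 * (fpFrob (fpGrad (fun y => p1Disp a h U b₀ A (y₀ + y)) x) -
            fpSymSq (fpGrad (fun y => p1Disp a h U b₀ A (y₀ + y)) x))))) +
      ∫ x, (7 * D + C) / 4 * fpChi S1 S2 x ^ 2 * (fpSq x)⁻¹ ^ 5 * fpDot x (p1Disp a h U b₀ A (y₀ + x)) ^ 2 :=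
    integral_add hG hR
  rw [integral_congr_ae (Eventually.of_forall hpt), e1, e2]

/-! ## The gradient part as a cell sum with re-centred weights -/

/-- **Cell decomposition for the translated field**: `∫ w(x)·g(∇ṽ(x))dx = Σ'_T g(G_T(U) − A)·∫_T w(y − y₀)dy` for any weight `w` and gradient functional `g`
(integrability assumed).  NOT a proof of H12⋆, NOT summit progress. -/
theorem integral_weight_fpGrad_translate_eq_tsum {a h : ℝ} (ha : a ≠ 0) (hh : h ≠ 0) (U : ℤ × ℤ × ℤ → (Fin 3 → ℝ)) (b₀ : Fin 3 → ℝ)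
    (A : Fin 3 → Fin 3 → ℝ) (y₀ : Fin 3 → ℝ) (w : (Fin 3 → ℝ) → ℝ) (g : (Fin 3 → Fin 3 → ℝ) → ℝ)
    (hint : Integrable fun x => w x * g (fpGrad (fun y => p1Disp a h U b₀ A (y₀ + y)) x)) :
    ∫ x, w x * g (fpGrad (fun y => p1Disp a h U b₀ A (y₀ + y)) x) =
      ∑' i, g (fun j k => p1CellGrad a h U i j k - A j k) * ∫ y in p1RealCell a h i, w (y - y₀) := by
  set H : (Fin 3 → ℝ) → ℝ := fun y => w (y - y₀) * g (fpGrad (p1Disp a h U b₀ A) y) with hHdef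
  have hpt : ∀ x, w x * g (fpGrad (fun y => p1Disp a h U b₀ A (y₀ + y)) x) = H (y₀ + x) := by
    intro x
    rw [fpGrad_comp_add_left, hHdef]
    simp only [add_sub_cancel_left]
  have hH : Integrable H := by
    refine (hint.comp_add_left (-y₀)).congr (Eventually.of_forall fun y => ?_)
    simp only [hpt, add_neg_cancel_left]
  have hrw : (fun x => w x * g (fpGrad (fun y => p1Disp a h U b₀ A (y₀ + y)) x)) = fun x => H (y₀ + x) := funext hpt
  rw [hrw, integral_add_left_eq_self H y₀, hHdef, integral_weight_fpGrad_eq_tsum ha hh U b₀ A (fun y => w (y - y₀)) g hH]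

/-- **The gradient part of `N(f_S,f_A,·,·)` for the translated field as a cell sum**:
`∫χ²[(f_S/24)s⁻³|symG|² + (f_A/24)s⁻³(|G|²_F − |symG|²)] = Σ'_T [(f_S/24)|sym(G_T−A)|² + (f_A/24)(|G_T−A|²_F − |sym(G_T−A)|²)]·∫_T χ(y−y₀)²|y−y₀|⁻⁶dy`.
NOT a proof of H12⋆, NOT summit progress. -/
theorem integral_chiSq_grad_translate_eq_tsum {a h S1 S2 : ℝ} (ha : 0 < a) (hh : 0 < h) (hS1 : 0 < S1) (hS12 : S1 < S2)
    (fS fA D C : ℝ) (hDC : 0 ≤ (7 * D + C) / 4) (hC : 0 ≤ C / 4)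
    (U : ℤ × ℤ × ℤ → (Fin 3 → ℝ)) (hU : (support U).Finite) (b₀ : Fin 3 → ℝ) (A : Fin 3 → Fin 3 → ℝ) (y₀ : Fin 3 → ℝ) :
    ∫ x, fpChi S1 S2 x ^ 2 *
        (fS * (1 / 24 * (fpSq x)⁻¹ ^ 3 * fpSymSq (fpGrad (fun y => p1Disp a h U b₀ A (y₀ + y)) x)) +
          fA * (1 / 24 * (fpSq x)⁻¹ ^ 3 * (fpFrob (fpGrad (fun y => p1Disp a h U b₀ A (y₀ + y)) x) -
            fpSymSq (fpGrad (fun y => p1Disp a h U b₀ A (y₀ + y)) x)))) =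
      ∑' i, (fS * (1 / 24 * fpSymSq (fun j k => p1CellGrad a h U i j k - A j k)) +
          fA * (1 / 24 * (fpFrob (fun j k => p1CellGrad a h U i j k - A j k) - fpSymSq (fun j k => p1CellGrad a h U i j k - A j k)))) *
        ∫ y in p1RealCell a h i, fpChi S1 S2 (y - y₀) ^ 2 * (fpSq (y - y₀))⁻¹ ^ 3 := by
  have hG := (integral_chiSq_fpNumI_split ha hh hS1 hS12 fS fA D C hDC hC U hU b₀ A y₀).1
  -- rewrite the integrand as w(x)·g(∇ṽ(x))
  have hpt : ∀ x, fpChi S1 S2 x ^ 2 *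
        (fS * (1 / 24 * (fpSq x)⁻¹ ^ 3 * fpSymSq (fpGrad (fun y => p1Disp a h U b₀ A (y₀ + y)) x)) +
          fA * (1 / 24 * (fpSq x)⁻¹ ^ 3 * (fpFrob (fpGrad (fun y => p1Disp a h U b₀ A (y₀ + y)) x) -
            fpSymSq (fpGrad (fun y => p1Disp a h U b₀ A (y₀ + y)) x)))) =
      (fpChi S1 S2 x ^ 2 * (fpSq x)⁻¹ ^ 3) *
        (fS * (1 / 24 * fpSymSq (fpGrad (fun y => p1Disp a h U b₀ A (y₀ + y)) x)) +
          fA * (1 / 24 * (fpFrob (fpGrad (fun y => p1Disp a h U b₀ A (y₀ + y)) x) -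
            fpSymSq (fpGrad (fun y => p1Disp a h U b₀ A (y₀ + y)) x)))) := fun x => by ring
  have hint : Integrable fun x => (fpChi S1 S2 x ^ 2 * (fpSq x)⁻¹ ^ 3) *
      (fS * (1 / 24 * fpSymSq (fpGrad (fun y => p1Disp a h U b₀ A (y₀ + y)) x)) +
        fA * (1 / 24 * (fpFrob (fpGrad (fun y => p1Disp a h U b₀ A (y₀ + y)) x) -
          fpSymSq (fpGrad (fun y => p1Disp a h U b₀ A (y₀ + y)) x)))) := hG.congr (Eventually.of_forall hpt)
  rw [integral_congr_ae (Eventually.of_forall hpt)]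
  rw [integral_weight_fpGrad_translate_eq_tsum ha.ne' hh.ne' U b₀ A y₀ (fun x => fpChi S1 S2 x ^ 2 * (fpSq x)⁻¹ ^ 3)
    (fun G => fS * (1 / 24 * fpSymSq G) + fA * (1 / 24 * (fpFrob G - fpSymSq G))) hint]

end Summit.AtomisticToContinuum.Crystallization.Theorems.StrictSplittingRuleBirth

end
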